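import Literature.MathematicalPhysics.QuantumFieldTheory.Balaban1983to89.B4Eq35TwoScalePosDef
import Literature.MathematicalPhysics.QuantumFieldTheory.Balaban1983to89.B4Eq16GreenExists
import Literature.MathematicalPhysics.QuantumFieldTheory.Balaban1983to89.B4NextAvg52

/-!
# [B4] (1.13) and (3.5) EXIST FOR EVERY CONFIGURATION: on the concrete two-level carriers the conditioned propagator
`C^{(k)}_Λ(Ω, A) = ((Δ^{(k)}(Ω,A) + aL^{−2}P(A))|_Λ)^{−1}` and the two-scale form of `G_k(Ω, Λ, A)` are positive
definite for every vector field `A`, every `m² ≥ 0`, `a_k, a > 0` — no regularity, no smallness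

T. Bałaban, *Regularity and decay of lattice Green's functions*, Commun. Math. Phys. **89** (1983) 571–597
[Balaban1983RegularityDecay] (= [B4]; journal page = PDF page + 570).

statement-level skeleton of published theorems with citation tags; proofs where landed; nothing here is a claim about the Yang–Mills mass gap

PDF held: `paper:balaban1983-cmp89-regularity-decay`; pp. 572–574 [PDF 2–4], 586–588 [PDF 16–18], 593 [PDF 23].

WHAT IS REPRODUCED = SKELETON rows **B4.Eq1.13** / **B4.Eq3.5** (the displays DEFINE inverses) and the standing
hypothesis `hKΛ`/`hKU` of row **B4.Prop2.3[I]**'s §3/§5 routes (owner r01), unit `lit-balaban-p35` gen 4 (Phase-2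
proof seat, free-target protocol G.5-34(d); HOME `run/shared/lean/pub/lit-balaban/`); file 2 of 2 (file 1
`B4Eq35TwoScalePosDef`: the plain-matrix mechanism, positivity from the zero-mode hypothesis `hzero`).  CARRIERS
(p17's, of the §5 route `B4NextAvg52`/`B4Ineq53RegularRegion`/`B4Prop23RegularRegion`, consumed BY NAME): the fine
region `fineDom n (fineDom L Zc)` over the unit region `Ω^{(k)} = fineDom L Zc` over the `L`-block labels
`Zc = Ω^{(k+1)}`; `H = hamR F e m² Ω A n` the form of `−Δ^{η,N}_{A,Ω} + m²` (1.3); `Q_k = QkR` the unit-block averaging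
(1.4) with the staircase transporters; `Q = nextAvg` the `L`-block averaging (5.2)/(3.2) with the unit-lattice
transporters `U(A(Γ_{z,y}))` of the induced field `uField n A`.

WHAT IS PROVED HERE (0 sorry, standard axioms, no new definitions).  The zero-mode hypothesis of file 1 HOLDS FOR
EVERY CONFIGURATION (**`twoLevel_ker`**): a field `Φ` with `⟨Φ, (−Δ^{η,N}_{A,Ω} + m²)Φ⟩ = 0` is covariantly constant
along the fine bonds (`hamR_form_eq_zero_const`); transport along the fine staircases gives
`(Q_k(A)Φ)(y) = c·φ(n·y)` (`trn_fld_eq`, `fld_QkR_eq`); the unit-lattice link `U(A(⟨y, y+e_μ⟩))` IS the transport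
along the straight fine segment (`B4Prop31Holonomy.clink`), so `y ↦ φ(n·y)` is covariantly constant on the unit
lattice in both orientations (`clink_const`, `linkR_const`), and transport along the unit staircases gives
`(Q(A)Q_k(A)Φ)(z) = c′(z)·φ(n·L·z)` with `c′(z) > 0` (`transR_const`, `fld_nextAvg_QkR_eq`); hence `QQ_kΦ = 0` forces
`φ = 0` at the base corners and then everywhere, all transporters being orthogonal — the two-level analogue of
`B4Eq16GreenExists.eq_zero_of_covOp_form_eq_zero`, ours and elementary (the paper does not pause on it).
CONSEQUENCES, for every `n, L ≥ 1`, every finite `Zc`, every vector field `A`, flow `F`, coupling `e`, `a_k, a > 0`,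
`m² ≥ 0`: `kForm_twoLevel_posDef` ((1.6), = `B4Eq16GreenExists.b4Op_region_posDef`), **`kLam_twoLevel_posDef`**
((3.5) for every block-compatible `(Λ, Λ′)` — the hypothesis `hKΛ` DISCHARGED), **`kLam_twoLevel_univ_posDef`** (the
form of `G^η_{k+1}(Ω,A)` (3.9) — `hKU` DISCHARGED), **`form113_twoLevel_posDef`** (the operator of (1.13)/(1.15) on
`Ω^{(k)}`), **`cOpLam_twoLevel_posDef`** (EVERY `Λ`), `cLam_twoLevel_mul_cOpLam`, `cOpLam_twoLevel_mul_cLam`,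
`cLam_twoLevel_posDef` — (1.13) is an honest inverse, itself positive definite; and (§4, gen 5) **`rep36_twoLevel`** —
THE REPRESENTATION (3.6) «C^{(k)}_Λ(Ω,A) = TG_k(Ω,Λ,A)T^* − (a_{k+1}/a_k²)L^{−2}P(A) + δ/a_k» (r01's `B4GaussRep36.Rep36`,
proof `B4GaussRep36Proof.rep36`) FOR EVERY CONFIGURATION on these carriers, its positivity hypothesis (3.5) now
discharged (`B4Sect3BlockAveraging.rep36_of_kLam_posDef` + `kLam_twoLevel_posDef` + `B4NextAvg52.rowOrtho_nextAvg`).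

HONEST SCOPE.  (a) Qualitative: no constants uniform in `η, Ω, A` (those are (1.15)/(1.8), proved under regularity
and smallness in `B4Ineq53RegularRegion`/`B4Lower18*`); the remark that no smallness of `A` is needed, also at
`m² = 0`, is ours, not printed in [B4].  (b) Geometry of the `B4*` lineage: finite unions of blocks of `ℤ^{d+1}` (two
nested levels), not the torus.  (c) The colour index rides along in `Λ ⊂ Ω^{(k)} × {colours}` exactly as in p17's
`B4Prop23RegularRegion` (finer than the print's `Λ ⊂ Ω^{(k)}`); block compatibility of `(Λ,Λ′)` is a binder, as in
r01's routes.  (d) Nothing printed is weakened or asserted beyond (1.13)/(3.5) being definitions of inverses that exist.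
-/

namespace Literature.MathematicalPhysics.QuantumFieldTheory.Balaban1983to89.B4Eq35TwoLevelPosDef

open Matrix Finset
open Literature.MathematicalPhysics.QuantumFieldTheory.Balaban1983to89.B4GaugeCovariance (OrthFlow avgOp covLap
  covLap_form fieldLink contourTrans transport fld fld_avgOp_mulVec pathEnd)
open Literature.MathematicalPhysics.QuantumFieldTheory.Balaban1983to89.B4Lower18Regular (PathRel transport_fieldLink
  dotProduct_self_nonneg' e1 seg pathEnd_seg mem_seg)
open Literature.MathematicalPhysics.QuantumFieldTheory.Balaban1983to89.B4Lower18RegularRegion (regWt rBlkWt rbaseEmb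
  rstairContour rstairContour_path rstairContour_end rbaseEmb_blk compField compField_sub pathRel_mono regWt_nonneg
  rBlkWt_nonneg rBlkWt_ne_zero)
open Literature.MathematicalPhysics.QuantumFieldTheory.Balaban1983to89.B4Lower18 (fineDom mem_fineDom)
open Literature.MathematicalPhysics.QuantumFieldTheory.Balaban1983to89.B4Reflection242 (blk nbrs mem_nbrs blk_mul)
open Literature.MathematicalPhysics.QuantumFieldTheory.Balaban1983to89.B4Prop31Holonomy (base base_add_e1 clink
  clink_orth blk_base_add_nsmul)
open Literature.MathematicalPhysics.QuantumFieldTheory.Balaban1983to89.B4Prop31Charts (linkR transR transR_orth)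
open Literature.MathematicalPhysics.QuantumFieldTheory.Balaban1983to89.B4NextAvg52 (uField clink_eq_uField
  linkR_uField_step nextAvg qL rowOrtho_nextAvg)
open Literature.MathematicalPhysics.QuantumFieldTheory.Balaban1983to89.B4Cor23Rep36Bridge (hamR qkR QkR
  kForm_eq_regionOp hamR_isSymm blkR trn_mul_transpose)
open Literature.MathematicalPhysics.QuantumFieldTheory.Balaban1983to89.B4Cor23RegionDeltaAlg (lnk trn)
open Literature.MathematicalPhysics.QuantumFieldTheory.Balaban1983to89.B4Lemma21Region (regionOp)
open Literature.MathematicalPhysics.QuantumFieldTheory.Balaban1983to89.B4GaussRep36 (kForm gk deltaK pOp cOpLam cLam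
  qNext kLam aNext diagInd BlockCompatible rep36Rhs)
open Literature.MathematicalPhysics.QuantumFieldTheory.Balaban1983to89.B4Sect3BlockAveraging (rep36_of_kLam_posDef)
open Literature.MathematicalPhysics.QuantumFieldTheory.Balaban1983to89.B4Eq16GreenExists (transport_mulVec_eq_of_pathRel
  transport_transpose_mul_self b4Op_region_posDef)
open Literature.MathematicalPhysics.QuantumFieldTheory.Balaban1983to89.B4Eq35TwoScalePosDef (form113_posDef
  posDef_submatrix_of_injective kLam_posDef kLam_univ_posDef)

/-! ## §2. The concrete two-level carriers: the zero-mode hypothesis proved for every configuration -/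

section TwoLevel

variable {d : ℕ} {ι : Type} [Fintype ι] [DecidableEq ι]

/-- zero modes of a covariant Laplacian form: `⟨Φ, (−Δ_W)Φ⟩ = 0` with weights `c ≥ 0` makes `φ` covariantly
constant along every positively weighted pair. [cite: Balaban1983RegularityDecay, (1.3) p.572] -/
theorem covLap_const_of_form_eq_zero {X : Type*} [Fintype X] [DecidableEq X] {c : X → X → ℝ}
    (hc : ∀ x y, 0 ≤ c x y) (W : X → X → Matrix ι ι ℝ) {Φ : X × ι → ℝ} (h0 : Φ ⬝ᵥ (covLap c W *ᵥ Φ) = 0) :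
    ∀ x y, 0 < c x y → W x y *ᵥ fld Φ y = fld Φ x := by
  rw [covLap_form] at h0
  intro x y hxy
  have hx := (Finset.sum_eq_zero_iff_of_nonneg fun x' _ => Finset.sum_nonneg fun y' _ =>
    mul_nonneg (hc x' y') (dotProduct_self_nonneg' _)).1 h0 x (Finset.mem_univ x)
  have hxy' := (Finset.sum_eq_zero_iff_of_nonneg fun y' _ =>
    mul_nonneg (hc x y') (dotProduct_self_nonneg' _)).1 hx y (Finset.mem_univ y)
  rcases mul_eq_zero.1 hxy' with h | h
  · exact absurd h hxy.ne'
  · exact sub_eq_zero.1 (dotProduct_self_eq_zero.1 h)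

/-- an orthogonal matrix kills only the zero vector (private plumbing). [folklore] -/
private theorem eq_zero_of_orth_mulVec {O : Matrix ι ι ℝ} (hO : Oᵀ * O = 1) {v : ι → ℝ} (hv : O *ᵥ v = 0) :
    v = 0 := by
  have h : (Oᵀ * O) *ᵥ v = 0 := by rw [← Matrix.mulVec_mulVec, hv, Matrix.mulVec_zero]
  rwa [hO, Matrix.one_mulVec] at h

variable (F : OrthFlow ι) (e : ℝ) {n : ℕ} (hn : 1 ≤ n) (m2 : ℝ) (Ωc : Finset (Fin (d + 1) → ℤ))
  (Ac : (Fin (d + 1) → ℤ) → Fin (d + 1) → ℝ)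

/-- **THE FORM OF `H = −Δ^{η,N}_{A,Ω} + m²` IS NON-NEGATIVE** (`m² ≥ 0`), for every vector field.
[cite: Balaban1983RegularityDecay, (1.3) p.572, (1.6) p.572] -/
theorem hamR_form_nonneg (hm : 0 ≤ m2) (n : ℕ) (Φ : ↥(fineDom n Ωc) × ι → ℝ) :
    0 ≤ Φ ⬝ᵥ (hamR F e m2 Ωc Ac n *ᵥ Φ) := by
  rw [hamR, Matrix.add_mulVec, dotProduct_add, Matrix.smul_mulVec, Matrix.one_mulVec, dotProduct_smul, smul_eq_mul,
    covLap_form]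
  refine add_nonneg ?_ (mul_nonneg hm (dotProduct_self_nonneg' Φ))
  exact Finset.sum_nonneg fun x _ => Finset.sum_nonneg fun y _ =>
    mul_nonneg (regWt_nonneg n _ x y) (dotProduct_self_nonneg' _)

include hn in
/-- **A ZERO MODE OF `H = −Δ^{η,N}_{A,Ω} + m²` IS COVARIANTLY CONSTANT ALONG THE BONDS OF `Ω`**: `⟨Φ,HΦ⟩ = 0`
(`m² ≥ 0`) gives `U(A_{⟨u,v⟩})φ(v) = φ(u)` for all nearest neighbours `u, v` of the fine region.
[cite: Balaban1983RegularityDecay, (1.3) p.572] -/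
theorem hamR_form_eq_zero_const (hm : 0 ≤ m2) {Φ : ↥(fineDom n Ωc) × ι → ℝ}
    (h0 : Φ ⬝ᵥ (hamR F e m2 Ωc Ac n *ᵥ Φ) = 0) :
    ∀ u v : ↥(fineDom n Ωc), v.1 ∈ nbrs u.1 → lnk F e n Ωc Ac u v *ᵥ fld Φ v = fld Φ u := by
  rw [hamR, Matrix.add_mulVec, dotProduct_add, Matrix.smul_mulVec, Matrix.one_mulVec, dotProduct_smul,
    smul_eq_mul] at h0
  have h1 : 0 ≤ Φ ⬝ᵥ (covLap (regWt n (fineDom n Ωc)) (lnk F e n Ωc Ac) *ᵥ Φ) := by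
    rw [covLap_form]
    exact Finset.sum_nonneg fun x _ => Finset.sum_nonneg fun y _ =>
      mul_nonneg (regWt_nonneg n _ x y) (dotProduct_self_nonneg' _)
  have h2 : 0 ≤ m2 * (Φ ⬝ᵥ Φ) := mul_nonneg hm (dotProduct_self_nonneg' Φ)
  have hL : Φ ⬝ᵥ (covLap (regWt n (fineDom n Ωc)) (lnk F e n Ωc Ac) *ᵥ Φ) = 0 := by linarith
  intro u v huv
  refine covLap_const_of_form_eq_zero (regWt_nonneg n _) _ hL u v ?_
  have hn' : (0 : ℝ) < n := by exact_mod_cast hn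
  simp only [regWt, if_pos huv, mul_one]
  positivity

/-- **TRANSPORT ALONG THE FINE STAIRCASE** `Γ^{(k)}_{y,x}`: for a covariantly constant `φ` and `x ∈ B(y)`,
`U(A(Γ_{y,x}))φ(x) = φ(n·y)` (the base corner of the block). [cite: Balaban1983RegularityDecay, (1.4) p.572] -/
theorem trn_fld_eq {Φ : ↥(fineDom n Ωc) × ι → ℝ}
    (hcc : ∀ u v : ↥(fineDom n Ωc), v.1 ∈ nbrs u.1 → lnk F e n Ωc Ac u v *ᵥ fld Φ v = fld Φ u)
    (y : ↥Ωc) (x : ↥(fineDom n Ωc)) (hx : blk n x.1 = y.1) :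
    trn F e hn Ωc Ac y x *ᵥ fld Φ x = fld Φ (rbaseEmb hn Ωc y) := by
  have hw : rBlkWt n Ωc (fineDom n Ωc) y x ≠ 0 := by simp [rBlkWt, hx]
  have h := transport_mulVec_eq_of_pathRel (lnk F e n Ωc Ac) (fld Φ) (rbaseEmb hn Ωc y) (rstairContour hn Ωc y x)
    (pathRel_mono (fun u v huv => hcc u v huv.1) _ _ (rstairContour_path hn Ωc y x))
  rw [rstairContour_end hn Ωc y x hw] at h
  exact h

/-- **THE UNIT-BLOCK AVERAGE OF A COVARIANTLY CONSTANT FIELD**: `(Q_k(A)Φ)(y) = (Σ_x q_k(y,x))·φ(n·y)`.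
[cite: Balaban1983RegularityDecay, (1.4) p.572] -/
theorem fld_QkR_eq {Φ : ↥(fineDom n Ωc) × ι → ℝ}
    (hcc : ∀ u v : ↥(fineDom n Ωc), v.1 ∈ nbrs u.1 → lnk F e n Ωc Ac u v *ᵥ fld Φ v = fld Φ u) (y : ↥Ωc) :
    fld (QkR F e hn Ωc Ac *ᵥ Φ) y = (∑ x, qkR n Ωc y x) • fld Φ (rbaseEmb hn Ωc y) := by
  rw [QkR, fld_avgOp_mulVec, Finset.sum_smul]
  refine Finset.sum_congr rfl fun x _ => ?_
  by_cases h : qkR n Ωc y x = 0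
  · rw [h, zero_smul, zero_smul]
  · have hb : blk n x.1 = y.1 := by
      refine rBlkWt_ne_zero (n := n) (Ωc := Ωc) (R := fineDom n Ωc) (y := y) (x := x) fun h0 => h ?_
      rw [qkR, h0, mul_zero]
    rw [trn_fld_eq F e hn Ωc Ac hcc y x hb]

/-- a contour of subtype points whose members satisfy a pointwise relation between consecutive points: the straight
fine segment version (private plumbing for `clink_const`). [folklore] -/
private theorem pathRel_seg_of {r : (Fin (d + 1) → ℤ) → (Fin (d + 1) → ℤ) → Prop} {P : (Fin (d + 1) → ℤ) → Prop}
    (μ : Fin (d + 1)) (hr : ∀ u, P u → P (u + e1 μ) → r u (u + e1 μ)) :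
    ∀ (m : ℕ) (p : Fin (d + 1) → ℤ), (∀ u ∈ p :: seg μ p m, P u) → PathRel r p (seg μ p m) := by
  intro m
  induction m with
  | zero => intro p _; trivial
  | succ m ih =>
      intro p hP
      have hp : P p := hP p List.mem_cons_self
      have hP' : ∀ u ∈ (p + e1 μ) :: seg μ (p + e1 μ) m, P u := fun u hu => hP u (List.mem_cons_of_mem _ hu)
      exact ⟨hr p hp (hP' _ List.mem_cons_self), ih _ hP'⟩

/-- **THE UNIT-LATTICE LINK `U(A(⟨y, y+e_μ⟩))` IS THE TRANSPORT ALONG THE STRAIGHT FINE SEGMENT**, so for a field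
covariantly constant along the fine bonds `U(A(⟨y,y+e_μ⟩))φ(n·(y+e_μ)) = φ(n·y)`.
[cite: Balaban1983RegularityDecay, p. 574 (1.22), p. 593 (5.2) «U(A(⟨x,x′⟩))»] -/
theorem clink_const {Ω : Finset (Fin (d + 1) → ℤ)} {Φ : ↥(fineDom n Ω) × ι → ℝ}
    (hcc : ∀ u v : ↥(fineDom n Ω), v.1 ∈ nbrs u.1 → lnk F e n Ω Ac u v *ᵥ fld Φ v = fld Φ u)
    (y : ↥Ω) (μ : Fin (d + 1)) (hy' : y.1 + e1 μ ∈ Ω) :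
    clink F (e / n) Ac n y.1 μ *ᵥ fld Φ (rbaseEmb hn Ω ⟨y.1 + e1 μ, hy'⟩) = fld Φ (rbaseEmb hn Ω y) := by
  classical
  -- the field extended by zero to all of `ℤ^{d+1}`
  set Φ' : (Fin (d + 1) → ℤ) → ι → ℝ := fun u => if h : u ∈ fineDom n Ω then fld Φ ⟨u, h⟩ else 0 with hΦ'
  -- every point of the segment `n·y, n·y + e_μ, …, n·(y + e_μ)` lies in the fine region
  have hmem : ∀ u ∈ base n y.1 :: seg μ (base n y.1) n, u ∈ fineDom n Ω := by
    intro u hu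
    rcases List.mem_cons.1 hu with rfl | hu
    · rw [mem_fineDom hn, show blk n (base n y.1) = y.1 from blk_mul hn y.1]; exact y.2
    · obtain ⟨j, hj, rfl⟩ := mem_seg hu
      rcases hj.lt_or_eq with hj | hj
      · rw [mem_fineDom hn, blk_base_add_nsmul hn y.1 μ hj]; exact y.2
      · rw [hj, ← base_add_e1, mem_fineDom hn, show blk n (base n (y.1 + e1 μ)) = y.1 + e1 μ from blk_mul hn _]
        exact hy'
  -- consecutive points are covariantly related
  have hrel : PathRel (fun u v => fieldLink F (e / n) (compField Ac) u v *ᵥ Φ' v = Φ' u) (base n y.1)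
      (seg μ (base n y.1) n) := by
    refine pathRel_seg_of (P := fun u => u ∈ fineDom n Ω) μ (fun u hu hv => ?_) n (base n y.1) hmem
    simp only [hΦ', dif_pos hu, dif_pos hv]
    exact hcc ⟨u, hu⟩ ⟨u + e1 μ, hv⟩ (mem_nbrs.2 ⟨μ, Or.inl rfl⟩)
  have h := transport_mulVec_eq_of_pathRel (fieldLink F (e / n) (compField Ac)) Φ' (base n y.1)
    (seg μ (base n y.1) n) hrel
  rw [pathEnd_seg, ← base_add_e1] at h
  have h1 : Φ' (base n (y.1 + e1 μ)) = fld Φ (rbaseEmb hn Ω ⟨y.1 + e1 μ, hy'⟩) := by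
    have hm : base n (y.1 + e1 μ) ∈ fineDom n Ω := by
      rw [mem_fineDom hn, show blk n (base n (y.1 + e1 μ)) = y.1 + e1 μ from blk_mul hn _]; exact hy'
    simp only [hΦ', dif_pos hm]
    rfl
  have h2 : Φ' (base n y.1) = fld Φ (rbaseEmb hn Ω y) := by
    have hm : base n y.1 ∈ fineDom n Ω := by
      rw [mem_fineDom hn, show blk n (base n y.1) = y.1 from blk_mul hn y.1]; exact y.2
    simp only [hΦ', dif_pos hm]
    rfl
  rw [h1, h2] at h
  rw [clink]
  exact h

/-- **COVARIANT CONSTANCY ON THE UNIT LATTICE**: for a field covariantly constant along the fine bonds, the sampled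
field `y ↦ φ(n·y)` is covariantly constant along the unit bonds for the unit-lattice links `U(A(⟨y,y′⟩))` of the
induced field `uField n A` (both orientations). [cite: Balaban1983RegularityDecay, p. 593 (5.2), p. 574 (1.22)] -/
theorem linkR_const {L : ℕ} {Zc : Finset (Fin (d + 1) → ℤ)} {Φ : ↥(fineDom n (fineDom L Zc)) × ι → ℝ}
    (hcc : ∀ u v : ↥(fineDom n (fineDom L Zc)), v.1 ∈ nbrs u.1 →
      lnk F e n (fineDom L Zc) Ac u v *ᵥ fld Φ v = fld Φ u)
    (y y' : ↥(fineDom L Zc)) (h : y'.1 ∈ nbrs y.1) :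
    linkR F (e / n) L Zc (uField n Ac) y y' *ᵥ fld Φ (rbaseEmb hn (fineDom L Zc) y')
      = fld Φ (rbaseEmb hn (fineDom L Zc) y) := by
  obtain ⟨μ, h1 | h2⟩ := mem_nbrs.1 h
  · -- forward bond `y' = y + e_μ`: the link IS the fine segment transport
    obtain ⟨v, hv⟩ := y'
    change v = y.1 + e1 μ at h1
    subst h1
    rw [linkR_uField_step F (e / n) Zc n Ac y ⟨y.1 + e1 μ, hv⟩ rfl]
    exact clink_const F e hn Ac hcc y μ hv
  · -- backward bond `y = y' + e_μ`: the link is the transpose of the forward one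
    obtain ⟨v, hv⟩ := y
    have h1 : v = y'.1 + e1 μ := by rw [h2]; simp [e1]
    subst h1
    have hfwd := clink_const F e hn Ac hcc y' μ hv
    have hlink : linkR F (e / n) L Zc (uField n Ac) ⟨y'.1 + e1 μ, hv⟩ y' = (clink F (e / n) Ac n y'.1 μ)ᵀ := by
      simp only [linkR, fieldLink]
      rw [compField_sub, clink_eq_uField, F.transpose_eq, mul_neg]
    rw [hlink, ← hfwd, Matrix.mulVec_mulVec, clink_orth, Matrix.one_mulVec]

/-- **TRANSPORT ALONG THE UNIT STAIRCASE** `Γ_{z,y}` of (5.2): for such a field and `y ∈ B(z)`,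
`U(A(Γ_{z,y}))φ(n·y) = φ(n·L·z)`. [cite: Balaban1983RegularityDecay, p. 593 (5.2), p. 587 (3.2)] -/
theorem transR_const {L : ℕ} (hL : 1 ≤ L) {Zc : Finset (Fin (d + 1) → ℤ)}
    {Φ : ↥(fineDom n (fineDom L Zc)) × ι → ℝ}
    (hcc : ∀ u v : ↥(fineDom n (fineDom L Zc)), v.1 ∈ nbrs u.1 →
      lnk F e n (fineDom L Zc) Ac u v *ᵥ fld Φ v = fld Φ u)
    (z : ↥Zc) (y : ↥(fineDom L Zc)) (hy : blk L y.1 = z.1) :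
    transR F (e / n) hL Zc (uField n Ac) z y *ᵥ fld Φ (rbaseEmb hn (fineDom L Zc) y)
      = fld Φ (rbaseEmb hn (fineDom L Zc) (rbaseEmb hL Zc z)) := by
  have hw : rBlkWt L Zc (fineDom L Zc) z y ≠ 0 := by simp [rBlkWt, hy]
  have h := transport_mulVec_eq_of_pathRel (linkR F (e / n) L Zc (uField n Ac))
    (fun y => fld Φ (rbaseEmb hn (fineDom L Zc) y)) (rbaseEmb hL Zc z) (rstairContour hL Zc z y)
    (pathRel_mono (fun u v huv => linkR_const F e hn Ac hcc u v huv.1) _ _ (rstairContour_path hL Zc z y))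
  rw [rstairContour_end hL Zc z y hw] at h
  rw [transR, contourTrans]
  exact h

/-- **THE TWO-LEVEL AVERAGE OF A COVARIANTLY CONSTANT FIELD**: `(Q(A)Q_k(A)Φ)(z) = c(z)·φ(n·L·z)` with the explicit
coefficient `c(z) = Σ_y q(z,y)Σ_x q_k(y,x)`. [cite: Balaban1983RegularityDecay, (3.1) p.587 «Q(A)(Q_k(A)φ) = Q_{k+1}(A)φ», (5.2) p.593] -/
theorem fld_nextAvg_QkR_eq {L : ℕ} (hL : 1 ≤ L) {Zc : Finset (Fin (d + 1) → ℤ)}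
    {Φ : ↥(fineDom n (fineDom L Zc)) × ι → ℝ}
    (hcc : ∀ u v : ↥(fineDom n (fineDom L Zc)), v.1 ∈ nbrs u.1 →
      lnk F e n (fineDom L Zc) Ac u v *ᵥ fld Φ v = fld Φ u) (z : ↥Zc) :
    fld (qNext (nextAvg F (e / n) hL Zc n Ac) (QkR F e hn (fineDom L Zc) Ac) *ᵥ Φ) z
      = (∑ y, qL L Zc z y * ∑ x, qkR n (fineDom L Zc) y x) •
          fld Φ (rbaseEmb hn (fineDom L Zc) (rbaseEmb hL Zc z)) := by
  rw [qNext, ← Matrix.mulVec_mulVec, nextAvg, fld_avgOp_mulVec, Finset.sum_smul]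
  refine Finset.sum_congr rfl fun y _ => ?_
  by_cases h : qL L Zc z y = 0
  · rw [h, zero_mul, zero_smul, zero_smul]
  · have hb : blk L y.1 = z.1 := by
      refine rBlkWt_ne_zero (n := L) (Ωc := Zc) (R := fineDom L Zc) (y := z) (x := y) fun h0 => h ?_
      rw [qL, h0, mul_zero]
    rw [fld_QkR_eq F e hn (fineDom L Zc) Ac hcc y, Matrix.mulVec_smul, transR_const F e hn Ac hL hcc z y hb,
      smul_smul]

include hn in
/-- the two-level coefficient is positive: it dominates the term of the base points, `L^{−(d+1)}·n^{−(d+1)/2} > 0`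
(private plumbing). [folklore] -/
private theorem coeff_pos {L : ℕ} (hL : 1 ≤ L) (Zc : Finset (Fin (d + 1) → ℤ)) (z : ↥Zc) :
    0 < ∑ y, qL L Zc z y * ∑ x, qkR n (fineDom L Zc) y x := by
  have hqL : ∀ y, 0 ≤ qL L Zc z y := fun y => by
    unfold qL; exact mul_nonneg (by positivity) (rBlkWt_nonneg L Zc _ z y)
  have hqk : ∀ (y : ↥(fineDom L Zc)) x, 0 ≤ qkR n (fineDom L Zc) y x := fun y x => by
    unfold qkR; exact mul_nonneg (Real.sqrt_nonneg _) (rBlkWt_nonneg n _ _ y x)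
  have hsum : ∀ y : ↥(fineDom L Zc), 0 ≤ ∑ x, qkR n (fineDom L Zc) y x := fun y => Finset.sum_nonneg fun x _ => hqk y x
  set y₀ := rbaseEmb hL Zc z with hy₀
  have h1 : 0 < qL L Zc z y₀ := by
    have hL0 : (0 : ℝ) < ((L ^ (d + 1) : ℕ) : ℝ) := by exact_mod_cast pow_pos hL (d + 1)
    simp only [qL, rBlkWt, hy₀, rbaseEmb_blk hL Zc z, if_true, mul_one]
    positivity
  have h2 : 0 < ∑ x, qkR n (fineDom L Zc) y₀ x := by
    have hx₀ : 0 < qkR n (fineDom L Zc) y₀ (rbaseEmb hn (fineDom L Zc) y₀) := by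
      have hn0 : (0 : ℝ) < ((n : ℝ) ^ (d + 1))⁻¹ := by
        have : (0 : ℝ) < n := by exact_mod_cast hn
        positivity
      simp only [qkR, rBlkWt, rbaseEmb_blk hn (fineDom L Zc) y₀, if_true, mul_one]
      exact Real.sqrt_pos.2 hn0
    exact lt_of_lt_of_le hx₀ (Finset.single_le_sum (fun x _ => hqk y₀ x) (Finset.mem_univ _))
  exact lt_of_lt_of_le (mul_pos h1 h2)
    (Finset.single_le_sum (fun y _ => mul_nonneg (hqL y) (hsum y)) (Finset.mem_univ y₀))

/-- **THE ZERO-MODE HYPOTHESIS HOLDS FOR EVERY CONFIGURATION**: on the two-level carriers (fine region over the unit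
region `Ω^{(k)} = fineDom L Zc` over the `L`-block labels `Zc`), a field `Φ` with `⟨Φ, (−Δ^{η,N}_{A,Ω} + m²)Φ⟩ = 0`
and `Q(A)Q_k(A)Φ = 0` vanishes — for every vector field `A`, every `m² ≥ 0`, every flow and coupling.
Mechanism: covariant constancy along fine bonds, fine staircases, unit links (= fine segments) and unit staircases
reduces `(QQ_kΦ)(z)` to a positive multiple of `φ(n·L·z)`; so `φ` vanishes at the base corners and, all
transporters being orthogonal, everywhere. [cite: Balaban1983RegularityDecay, (1.3)–(1.4) p.572, (3.1) p.587, (5.2) p.593] -/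
theorem twoLevel_ker {L : ℕ} (hL : 1 ≤ L) (Zc : Finset (Fin (d + 1) → ℤ)) (hm : 0 ≤ m2) :
    ∀ Φ : ↥(fineDom n (fineDom L Zc)) × ι → ℝ,
      Φ ⬝ᵥ (hamR F e m2 (fineDom L Zc) Ac n *ᵥ Φ) = 0 →
        qNext (nextAvg F (e / n) hL Zc n Ac) (QkR F e hn (fineDom L Zc) Ac) *ᵥ Φ = 0 → Φ = 0 := by
  intro Φ h0 hQ
  have hcc := hamR_form_eq_zero_const F e hn m2 (fineDom L Zc) Ac hm h0
  -- the field vanishes at the base corners `n·L·z`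
  have hbase : ∀ z : ↥Zc, fld Φ (rbaseEmb hn (fineDom L Zc) (rbaseEmb hL Zc z)) = 0 := by
    intro z
    have h := fld_nextAvg_QkR_eq F e hn Ac hL hcc z
    rw [hQ] at h
    have h' : (∑ y, qL L Zc z y * ∑ x, qkR n (fineDom L Zc) y x) •
        fld Φ (rbaseEmb hn (fineDom L Zc) (rbaseEmb hL Zc z)) = 0 := by rw [← h]; rfl
    rcases smul_eq_zero.1 h' with h'' | h''
    · exact absurd h'' (coeff_pos hn hL Zc z).ne'
    · exact h''
  -- hence at every unit base corner `n·y`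
  have hunit : ∀ y : ↥(fineDom L Zc), fld Φ (rbaseEmb hn (fineDom L Zc) y) = 0 := by
    intro y
    have h := transR_const F e hn Ac hL hcc (blkR hL Zc y) y rfl
    rw [hbase] at h
    exact eq_zero_of_orth_mulVec (transR_orth F (e / n) hL Zc (uField n Ac) _ y) h
  -- hence at every fine point
  funext p
  have h := trn_fld_eq F e hn (fineDom L Zc) Ac hcc (blkR hn (fineDom L Zc) p.1) p.1 rfl
  rw [hunit] at h
  have horth : (trn F e hn (fineDom L Zc) Ac (blkR hn (fineDom L Zc) p.1) p.1)ᵀ *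
      trn F e hn (fineDom L Zc) Ac (blkR hn (fineDom L Zc) p.1) p.1 = 1 :=
    mul_eq_one_comm.1 (trn_mul_transpose F e hn (fineDom L Zc) Ac _ p.1)
  exact congrFun (eq_zero_of_orth_mulVec horth h) p.2

/-- `K̂ = H + a_kQ_kᵀQ_k` on the two-level carriers is [B4]'s (1.6) on the region, positive definite for every `A`
(`B4Eq16GreenExists.b4Op_region_posDef`). [cite: Balaban1983RegularityDecay, (1.6) p.572] -/
theorem kForm_twoLevel_posDef {a : ℝ} (ha : 0 < a) (hm : 0 ≤ m2) :
    (kForm (hamR F e m2 Ωc Ac n) a (QkR F e hn Ωc Ac)).PosDef := by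
  rw [kForm_eq_regionOp, regionOp]
  exact b4Op_region_posDef F (e / n) hn ha hm Ωc _

/-- the coefficient `a_{k+1}L^{d+1}L^{−2}` of (3.5) is positive (private plumbing). [cite: Balaban1983RegularityDecay, (3.3)–(3.4) p.587] -/
private theorem coef35_pos {a a' : ℝ} (ha : 0 < a) (ha' : 0 < a') {L : ℕ} (hL : 1 ≤ L) :
    0 < aNext a' a (((L : ℝ) ^ 2)⁻¹) * (((L ^ (d + 1) : ℕ) : ℝ)) * (((L : ℝ) ^ 2)⁻¹) := by
  have hL0 : (0 : ℝ) < L := by exact_mod_cast hL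
  have hLd : (0 : ℝ) < ((L ^ (d + 1) : ℕ) : ℝ) := by exact_mod_cast pow_pos hL (d + 1)
  unfold aNext
  positivity

/-- **(3.5) IS WELL POSED FOR EVERY CONFIGURATION: the two-scale form `K̂_Λ` is POSITIVE DEFINITE** on the concrete
two-level carriers, for every `n, L ≥ 1`, every finite `Zc = Ω^{(k+1)}`, every vector field `A`, flow `F`, coupling
`e`, `a_k, a > 0`, `m² ≥ 0`, and every block-compatible pair `(Λ, Λ′)` — the hypothesis `hKΛ` of r01's §3/§5 routes
DISCHARGED with no regularity or smallness assumption. [cite: Balaban1983RegularityDecay, (3.5) p.587] -/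
theorem kLam_twoLevel_posDef {L : ℕ} (hL : 1 ≤ L) (Zc : Finset (Fin (d + 1) → ℤ)) {a a' : ℝ} (ha : 0 < a)
    (ha' : 0 < a') (hm : 0 ≤ m2) {Λ : Finset (↥(fineDom L Zc) × ι)} {Λ' : Finset (↥Zc × ι)}
    (hB : BlockCompatible (nextAvg F (e / n) hL Zc n Ac) Λ Λ') :
    (kLam (hamR F e m2 (fineDom L Zc) Ac n) a (QkR F e hn (fineDom L Zc) Ac) a' (((L : ℝ) ^ 2)⁻¹)
      (((L ^ (d + 1) : ℕ) : ℝ)) (nextAvg F (e / n) hL Zc n Ac) Λ Λ').PosDef :=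
  kLam_posDef (hamR_isSymm F e m2 (fineDom L Zc) Ac) (hamR_form_nonneg F e m2 (fineDom L Zc) Ac hm n) ha
    (coef35_pos ha ha' hL) hB (twoLevel_ker F e hn m2 Ac hL Zc hm)

/-- **THE FORM OF `G^η_{k+1}(Ω, A)` (3.9) IS POSITIVE DEFINITE FOR EVERY CONFIGURATION** on the two-level carriers —
the hypothesis `hKU` of r01's routes DISCHARGED. [cite: Balaban1983RegularityDecay, (3.5) p.587, (3.9) p.588] -/
theorem kLam_twoLevel_univ_posDef {L : ℕ} (hL : 1 ≤ L) (Zc : Finset (Fin (d + 1) → ℤ)) {a a' : ℝ} (ha : 0 < a)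
    (ha' : 0 < a') (hm : 0 ≤ m2) :
    (kLam (hamR F e m2 (fineDom L Zc) Ac n) a (QkR F e hn (fineDom L Zc) Ac) a' (((L : ℝ) ^ 2)⁻¹)
      (((L ^ (d + 1) : ℕ) : ℝ)) (nextAvg F (e / n) hL Zc n Ac) Finset.univ Finset.univ).PosDef :=
  kLam_univ_posDef (hamR_isSymm F e m2 (fineDom L Zc) Ac) (hamR_form_nonneg F e m2 (fineDom L Zc) Ac hm n) ha
    (coef35_pos ha ha' hL) (twoLevel_ker F e hn m2 Ac hL Zc hm)

/-- **THE OPERATOR `Δ^{(k)}(Ω,A) + aL^{−2}P(A)` OF (1.13)/(1.15) IS POSITIVE DEFINITE FOR EVERY CONFIGURATION** on the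
two-level carriers (`a_k, a > 0`, `m² ≥ 0`, every `A`). [cite: Balaban1983RegularityDecay, (1.13) p.573, (1.15) p.574] -/
theorem form113_twoLevel_posDef {L : ℕ} (hL : 1 ≤ L) (Zc : Finset (Fin (d + 1) → ℤ)) {a a' : ℝ} (ha : 0 < a)
    (ha' : 0 < a') (hm : 0 ≤ m2) :
    (deltaK (hamR F e m2 (fineDom L Zc) Ac n) a (QkR F e hn (fineDom L Zc) Ac)
      + (a' * ((L : ℝ) ^ 2)⁻¹) • pOp (((L ^ (d + 1) : ℕ) : ℝ)) (nextAvg F (e / n) hL Zc n Ac)).PosDef := by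
  have hL0 : (0 : ℝ) < L := by exact_mod_cast hL
  have hLd : (0 : ℝ) < ((L ^ (d + 1) : ℕ) : ℝ) := by exact_mod_cast pow_pos hL (d + 1)
  exact form113_posDef (hamR_form_nonneg F e m2 (fineDom L Zc) Ac hm n)
    (kForm_twoLevel_posDef F e hn m2 (fineDom L Zc) Ac ha hm) ha (by positivity) hLd
    (twoLevel_ker F e hn m2 Ac hL Zc hm)

/-- **THE OPERATOR `(Δ^{(k)}(Ω,A) + aL^{−2}P(A))|_Λ` OF (1.13) IS POSITIVE DEFINITE FOR EVERY `Λ` AND EVERY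
CONFIGURATION** on the two-level carriers. [cite: Balaban1983RegularityDecay, (1.13) p.573] -/
theorem cOpLam_twoLevel_posDef {L : ℕ} (hL : 1 ≤ L) (Zc : Finset (Fin (d + 1) → ℤ)) {a a' : ℝ} (ha : 0 < a)
    (ha' : 0 < a') (hm : 0 ≤ m2) (Λ : Finset (↥(fineDom L Zc) × ι)) :
    (cOpLam (hamR F e m2 (fineDom L Zc) Ac n) a (QkR F e hn (fineDom L Zc) Ac) a' (((L : ℝ) ^ 2)⁻¹)
      (((L ^ (d + 1) : ℕ) : ℝ)) (nextAvg F (e / n) hL Zc n Ac) Λ).PosDef :=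
  posDef_submatrix_of_injective (form113_twoLevel_posDef F e hn m2 Ac hL Zc ha ha' hm) Subtype.val_injective

/-- **(1.13) IS WELL POSED FOR EVERY CONFIGURATION: `C^{(k)}_Λ(Ω,A)·(Δ^{(k)}(Ω,A) + aL^{−2}P(A))|_Λ = 1`** on the
two-level carriers, for every `Λ`, every `A`, `a_k, a > 0`, `m² ≥ 0`. [cite: Balaban1983RegularityDecay, (1.13) p.573] -/
theorem cLam_twoLevel_mul_cOpLam {L : ℕ} (hL : 1 ≤ L) (Zc : Finset (Fin (d + 1) → ℤ)) {a a' : ℝ} (ha : 0 < a)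
    (ha' : 0 < a') (hm : 0 ≤ m2) (Λ : Finset (↥(fineDom L Zc) × ι)) :
    cLam (hamR F e m2 (fineDom L Zc) Ac n) a (QkR F e hn (fineDom L Zc) Ac) a' (((L : ℝ) ^ 2)⁻¹)
        (((L ^ (d + 1) : ℕ) : ℝ)) (nextAvg F (e / n) hL Zc n Ac) Λ
      * cOpLam (hamR F e m2 (fineDom L Zc) Ac n) a (QkR F e hn (fineDom L Zc) Ac) a' (((L : ℝ) ^ 2)⁻¹)
        (((L ^ (d + 1) : ℕ) : ℝ)) (nextAvg F (e / n) hL Zc n Ac) Λ = 1 := by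
  rw [cLam]
  exact Matrix.nonsing_inv_mul _
    ((Matrix.isUnit_iff_isUnit_det _).1 (cOpLam_twoLevel_posDef F e hn m2 Ac hL Zc ha ha' hm Λ).isUnit)

/-- `(Δ^{(k)}(Ω,A) + aL^{−2}P(A))|_Λ · C^{(k)}_Λ(Ω,A) = 1` on the two-level carriers, every `Λ`, every `A`.
[cite: Balaban1983RegularityDecay, (1.13) p.573] -/
theorem cOpLam_twoLevel_mul_cLam {L : ℕ} (hL : 1 ≤ L) (Zc : Finset (Fin (d + 1) → ℤ)) {a a' : ℝ} (ha : 0 < a)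
    (ha' : 0 < a') (hm : 0 ≤ m2) (Λ : Finset (↥(fineDom L Zc) × ι)) :
    cOpLam (hamR F e m2 (fineDom L Zc) Ac n) a (QkR F e hn (fineDom L Zc) Ac) a' (((L : ℝ) ^ 2)⁻¹)
        (((L ^ (d + 1) : ℕ) : ℝ)) (nextAvg F (e / n) hL Zc n Ac) Λ
      * cLam (hamR F e m2 (fineDom L Zc) Ac n) a (QkR F e hn (fineDom L Zc) Ac) a' (((L : ℝ) ^ 2)⁻¹)
        (((L ^ (d + 1) : ℕ) : ℝ)) (nextAvg F (e / n) hL Zc n Ac) Λ = 1 := by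
  rw [cLam]
  exact Matrix.mul_nonsing_inv _
    ((Matrix.isUnit_iff_isUnit_det _).1 (cOpLam_twoLevel_posDef F e hn m2 Ac hL Zc ha ha' hm Λ).isUnit)

/-- **`C^{(k)}_Λ(Ω,A) > 0` FOR EVERY `Λ` AND EVERY CONFIGURATION** on the two-level carriers (the covariance of the
Gaussian (3.1) is positive definite). [cite: Balaban1983RegularityDecay, (1.13) p.573, (3.1) p.586] -/
theorem cLam_twoLevel_posDef {L : ℕ} (hL : 1 ≤ L) (Zc : Finset (Fin (d + 1) → ℤ)) {a a' : ℝ} (ha : 0 < a)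
    (ha' : 0 < a') (hm : 0 ≤ m2) (Λ : Finset (↥(fineDom L Zc) × ι)) :
    (cLam (hamR F e m2 (fineDom L Zc) Ac n) a (QkR F e hn (fineDom L Zc) Ac) a' (((L : ℝ) ^ 2)⁻¹)
      (((L ^ (d + 1) : ℕ) : ℝ)) (nextAvg F (e / n) hL Zc n Ac) Λ).PosDef := by
  rw [cLam]
  exact (cOpLam_twoLevel_posDef F e hn m2 Ac hL Zc ha ha' hm Λ).inv

/-! ## §4. (3.6) for every configuration on the two-level carriers -/

/-- **(3.6) «C^{(k)}_Λ(Ω,A;y,y′) = ([−(a_{k+1}/a_k)L^{−2}Q^*(A)Q_{k+1}(A) + Q_k(A)]G_k(Ω,Λ,A)[−(a_{k+1}/a_k)L^{−2}Q^*_{k+1}(A)Q(A)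
+ Q^*_k(A)])(y,y′) − (a_{k+1}/a_k²)L^{−2}P(A;y,y′) + δ_{y,y′}/a_k» FOR EVERY CONFIGURATION on the two-level carriers**:
r01's typed identity `B4GaussRep36.Rep36` (proof `B4GaussRep36Proof.rep36`, economical form
`B4Sect3BlockAveraging.rep36_of_kLam_posDef`) with its remaining hypotheses DISCHARGED — the positivity of the
two-scale form (3.5) by `kLam_twoLevel_posDef`, `QQᵀ = L^{−(d+1)}·1` by `B4NextAvg52.rowOrtho_nextAvg` —: for every
`n, L ≥ 1`, every finite `Ω^{(k+1)}`, every vector field `A`, flow and coupling, `a_k, a > 0`, `m² ≥ 0` and every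
block-compatible pair `(Λ, Λ′)` («Λ being a sum of big blocks»). [cite: Balaban1983RegularityDecay, (3.6) p.588] -/
theorem rep36_twoLevel {L : ℕ} (hL : 1 ≤ L) (Zc : Finset (Fin (d + 1) → ℤ)) {a a' : ℝ} (ha : 0 < a)
    (ha' : 0 < a') (hm : 0 ≤ m2) {Λ : Finset (↥(fineDom L Zc) × ι)} {Λ' : Finset (↥Zc × ι)}
    (hB : BlockCompatible (nextAvg F (e / n) hL Zc n Ac) Λ Λ') :
    cLam (hamR F e m2 (fineDom L Zc) Ac n) a (QkR F e hn (fineDom L Zc) Ac) a' (((L : ℝ) ^ 2)⁻¹)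
        (((L ^ (d + 1) : ℕ) : ℝ)) (nextAvg F (e / n) hL Zc n Ac) Λ
      = rep36Rhs (hamR F e m2 (fineDom L Zc) Ac n) a (QkR F e hn (fineDom L Zc) Ac) a' (((L : ℝ) ^ 2)⁻¹)
        (((L ^ (d + 1) : ℕ) : ℝ)) (nextAvg F (e / n) hL Zc n Ac) Λ Λ' := by
  have hL0 : (0 : ℝ) < L := by exact_mod_cast hL
  have hLd : (0 : ℝ) < ((L ^ (d + 1) : ℕ) : ℝ) := by exact_mod_cast pow_pos hL (d + 1)
  exact rep36_of_kLam_posDef _ _ ha ha' (by positivity) hLd (rowOrtho_nextAvg F (e / n) hL Zc n Ac) hB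
    (kLam_twoLevel_posDef F e hn m2 Ac hL Zc ha ha' hm hB)

end TwoLevel

end Literature.MathematicalPhysics.QuantumFieldTheory.Balaban1983to89.B4Eq35TwoLevelPosDef
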